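import Summits.Ventures.WeilGRH.ThirdPrimeReflectionTransfer
import HarnessLib

/-!
# GRH arm (rh-explicit, venture WeilGRH): the DOUBLE reflection transfer (primes `2` AND `3` reflected)

On the two-prime window `[-a, a]`, `log 3 < 2a ≤ 2 log 2`, the prime powers `n = 2, 3` enter the
explicit formula of `k = g ⋆ g̃` and, for a character `χ` mod `q ≠ 1` (`ReflectionTransfer`,
`TwoPrimeReflectionTransfer` bookkeeping),

`Re Q_χ(g) ≥ Re Q_ζ(g) − 2|c|² + (log q)‖g‖₂² + 2k₂' Re[u₂ k(log 2)] + 2k₃' Re[u₃ k(log 3)]`,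

`k₂' = log 2/√2`, `k₃' = log 3/√3`, `u_n = 1 − χ(n)`, `c = ∫ g cosh(x/2)`. `TwoPrimeReflectionTransfer`
reflects `2` and pays `3` out of a budget; `ThirdPrimeReflectionTransfer` reflects `3` and pays `2`. Here
BOTH primes are reflected, at no extra analytic cost: the reflection inequality at the shift `L`
(`reflection_inequality_at`, `L = log 2` and `L = log 3`) gives, for budgets `B₂ > κ₂ = k₂'‖u₂‖`,
`B₃ > κ₃ = k₃'‖u₃‖`,

`|c|² ≤ W₂ · G₂`, `|c|² ≤ W₃ · G₃`, `W_n = B_n‖g‖₂² + 2κ_n Re(ω_n k(log n)) ≥ 0`,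

`u_n = ‖u_n‖ ω_n`, `G_n = C_M⁽ⁿ⁾/B_n + (C_A⁽ⁿ⁾ + Re ω_n·I_A⁽ⁿ⁾)/(B_n + κ_n) + (C_A⁽ⁿ⁾ − Re ω_n·I_A⁽ⁿ⁾)/(B_n − κ_n)`
with the closed forms of the window folded at `log n`. If `t₂ G₂ ≤ 1`, `t₃ G₃ ≤ 1` with `t₂ + t₃ ≥ 2` and
`B₂ + B₃ ≤ B ≤ log q`, then `2|c|² ≤ t₂|c|² + t₃|c|² ≤ W₂ + W₃ ≤ B‖g‖₂² + 2k₂'Re[u₂k(log 2)] + 2k₃'Re[u₃k(log 3)]`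
— a CONVEX COMBINATION of the two one-prime certificates — and Weil positivity for `ζ` on `[-a, a]` gives
`WeilPositivityOnChar χ a` (**double reflection transfer**). In cleared form the two conditions read
`t_n·[C_M⁽ⁿ⁾(B_n² − κ_n²) + 2B_n(B_n C_A⁽ⁿ⁾ − k_n'·Re(u_n)·I_A⁽ⁿ⁾)] ≤ B_n(B_n² − κ_n²)`.

Numerically (rh-explicit-weil-grh-2 gen3, `work/py/convex_combo.py`): at `a = 59/100` the double
reflection certifies 37 of the 46 conjugacy classes of primitive characters of conductor `≤ 20` (the exact
two-prime secular value: 39; with the parity bonus: 43) and EVERY character of EVERY modulus `q ≥ 12`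
(one-sided reflections: `q ≥ 32`); at `a = log 2`, 31 classes and every character mod `q ≥ 18` (was `50`).
The instances are in `DoubleReflectionRungs.lean`.

## References

* A. Weil (1952), (11) and the «lemme» p. 262; H. Yoshida (1992) §6 (polar bookkeeping).
-/

noncomputable section

open Complex Filter Set MeasureTheory
open scoped Real Topology ComplexConjugate ArithmeticFunction.vonMangoldt

namespace Summit.Ventures.WeilGRH

open Literature.NumberTheory.LFunctions

variable {q : ℕ} {g : ℝ → ℂ}

/-- The phase of a complex number: `u = ‖u‖·ω` with `‖ω‖ = 1` (any unit `ω` if `u = 0`). [folklore] -/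
theorem exists_norm_mul_phase (u : ℂ) : ∃ ω : ℂ, ‖ω‖ = 1 ∧ u = (‖u‖ : ℂ) * ω := by
  by_cases hu0 : u = 0
  · exact ⟨1, by simp, by simp [hu0]⟩
  · have hr' : ‖u‖ ≠ 0 := norm_ne_zero_iff.2 hu0
    refine ⟨u / (‖u‖ : ℂ), ?_, ?_⟩
    · rw [norm_div, Complex.norm_real, Real.norm_eq_abs, abs_of_nonneg (norm_nonneg _), div_self hr']
    · rw [mul_div_cancel₀ _ (by exact_mod_cast hr')]

/-- From the cleared one-prime criterion with a general factor `t`,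
`t·[C_M(B² − κ²) + 2B(B·C_A − κ Re(ω) I_A)] ≤ B(B² − κ²)` (`0 ≤ κ < B`), the bound `t·G ≤ 1` for
`G = C_M/B + (C_A + Re ω·I_A)/(B + κ) + (C_A − Re ω·I_A)/(B − κ)`. [folklore] -/
theorem mul_G_le_one_of_cleared {t CM CA IA B κ ρ : ℝ} (hκ : 0 ≤ κ) (hκB : κ < B)
    (hcrit : t * (CM * (B ^ 2 - κ ^ 2) + 2 * B * (B * CA - κ * ρ * IA)) ≤ B * (B ^ 2 - κ ^ 2)) :
    t * (CM / B + (CA + ρ * IA) / (B + κ) + (CA - ρ * IA) / (B - κ)) ≤ 1 := by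
  have hB : 0 < B := lt_of_le_of_lt hκ hκB
  have hBp : 0 < B + κ := by linarith
  have hBm : 0 < B - κ := by linarith
  set G : ℝ := CM / B + (CA + ρ * IA) / (B + κ) + (CA - ρ * IA) / (B - κ) with hG
  have hGB : G * (B * ((B + κ) * (B - κ))) =
      CM * (B ^ 2 - κ ^ 2) + 2 * B * (B * CA - κ * ρ * IA) := by
    rw [hG]
    field_simp
    ring
  have hpos : 0 < B * ((B + κ) * (B - κ)) := by positivity
  refine le_of_mul_le_mul_right ?_ hpos
  calc t * G * (B * ((B + κ) * (B - κ))) = t * (G * (B * ((B + κ) * (B - κ)))) := by ring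
    _ = t * (CM * (B ^ 2 - κ ^ 2) + 2 * B * (B * CA - κ * ρ * IA)) := by rw [hGB]
    _ ≤ B * (B ^ 2 - κ ^ 2) := hcrit
    _ = 1 * (B * ((B + κ) * (B - κ))) := by ring

/-- **DOUBLE REFLECTION TRANSFER (primes `2` and `3` both reflected; any parity, any `χ(2)`, `χ(3)`).**
Let `log 3 < 2a`, `a ≤ log 2`, `q ≠ 1`, `χ` mod `q`, `u_n = 1 − χ(n)`, `κ₂ = (log 2/√2)‖u₂‖`,
`κ₃ = (log 3/√3)‖u₃‖`, budgets `κ₂ < B₂`, `κ₃ < B₃` with `B₂ + B₃ ≤ B ≤ log q`, weights `t₂, t₃ ≥ 0`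
with `2 ≤ t₂ + t₃`, and `m_n, C_M⁽ⁿ⁾, C_A⁽ⁿ⁾, I_A⁽ⁿ⁾` the closed forms of the window folded at `log n`.
If Weil positivity for `ζ` holds on `[-a, a]` and the two cleared criteria
`t_n·[C_M⁽ⁿ⁾(B_n² − κ_n²) + 2B_n(B_n C_A⁽ⁿ⁾ − k_n' Re(u_n) I_A⁽ⁿ⁾)] ≤ B_n(B_n² − κ_n²)` hold
(`k₂' = log 2/√2`, `k₃' = log 3/√3`), then `WeilPositivityOnChar χ a`.
[cite: Weil1952FormulesExplicites, (11) and the «lemme» p. 262; Yoshida1992 §6] -/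
theorem weilPositivityOnChar_transfer_double_reflection [NeZero q] {a : ℝ}
    (ha3 : Real.log 3 < 2 * a) (ha4 : a ≤ Real.log 2) (hζ : WeilPositivityOn a) (hq1 : q ≠ 1)
    (χ : DirichletCharacter ℂ q) {B B₂ B₃ κ₂ κ₃ t₂ t₃ : ℝ} (hBq : B ≤ Real.log q)
    (hBB : B₂ + B₃ ≤ B)
    (hκ₂ : κ₂ = Real.log 2 / Real.sqrt 2 * ‖1 - χ (2 : ZMod q)‖)
    (hκ₃ : κ₃ = Real.log 3 / Real.sqrt 3 * ‖1 - χ (3 : ZMod q)‖)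
    (hκB₂ : κ₂ < B₂) (hκB₃ : κ₃ < B₃) (ht₂ : 0 ≤ t₂) (ht₃ : 0 ≤ t₃) (ht : 2 ≤ t₂ + t₃)
    {m₂ CM₂ CA₂ IA₂ : ℝ} (hm₂ : m₂ = Real.log 2 - a) (hCM₂ : CM₂ = Real.sinh m₂ + m₂)
    (hCA₂ : CA₂ = (Real.sinh a - Real.sinh m₂ + (a - m₂)) / 2)
    (hIA₂ : IA₂ = (a - m₂) * Real.cosh (Real.log 2 / 2) / 2 + Real.sinh (a - Real.log 2 / 2))
    {m₃ CM₃ CA₃ IA₃ : ℝ} (hm₃ : m₃ = Real.log 3 - a) (hCM₃ : CM₃ = Real.sinh m₃ + m₃)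
    (hCA₃ : CA₃ = (Real.sinh a - Real.sinh m₃ + (a - m₃)) / 2)
    (hIA₃ : IA₃ = (a - m₃) * Real.cosh (Real.log 3 / 2) / 2 + Real.sinh (a - Real.log 3 / 2))
    (hcrit₂ : t₂ * (CM₂ * (B₂ ^ 2 - κ₂ ^ 2) +
        2 * B₂ * (B₂ * CA₂ - Real.log 2 / Real.sqrt 2 * (1 - χ (2 : ZMod q)).re * IA₂)) ≤
      B₂ * (B₂ ^ 2 - κ₂ ^ 2))
    (hcrit₃ : t₃ * (CM₃ * (B₃ ^ 2 - κ₃ ^ 2) +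
        2 * B₃ * (B₃ * CA₃ - Real.log 3 / Real.sqrt 3 * (1 - χ (3 : ZMod q)).re * IA₃)) ≤
      B₃ * (B₃ ^ 2 - κ₃ ^ 2)) :
    WeilPositivityOnChar χ a := by
  intro g hg hsupp
  set L₂ := Real.log 2 with hL₂
  set L₃ := Real.log 3 with hL₃
  set k₂ : ℝ := Real.log 2 / Real.sqrt 2 with hk₂
  set k₃ : ℝ := Real.log 3 / Real.sqrt 3 with hk₃
  set u₂ : ℂ := 1 - χ (2 : ZMod q) with hu₂
  set u₃ : ℂ := 1 - χ (3 : ZMod q) with hu₃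
  have hk₂0 : 0 < k₂ := div_pos (Real.log_pos (by norm_num)) (by positivity)
  have hk₃0 : 0 < k₃ := div_pos (Real.log_pos (by norm_num)) (by positivity)
  have hκ₂0 : 0 ≤ κ₂ := by rw [hκ₂]; exact mul_nonneg hk₂0.le (norm_nonneg _)
  have hκ₃0 : 0 ≤ κ₃ := by rw [hκ₃]; exact mul_nonneg hk₃0.le (norm_nonneg _)
  have hlog23 : Real.log 2 < Real.log 3 := Real.log_lt_log (by norm_num) (by norm_num)
  have ha2 : Real.log 2 < 2 * a := hlog23.trans ha3
  -- the phases `ω₂, ω₃` of `u₂, u₃`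
  obtain ⟨ω₂, hω₂, huω₂⟩ := exists_norm_mul_phase u₂
  obtain ⟨ω₃, hω₃, huω₃⟩ := exists_norm_mul_phase u₃
  have hωre₂ : ‖u₂‖ * ω₂.re = u₂.re := by
    conv_rhs => rw [huω₂]
    rw [Complex.re_ofReal_mul]
  have hωre₃ : ‖u₃‖ * ω₃.re = u₃.re := by
    conv_rhs => rw [huω₃]
    rw [Complex.re_ofReal_mul]
  set kL₂ := weilConv g (weilReflect g) L₂ with hkL₂
  set kL₃ := weilConv g (weilReflect g) L₃ with hkL₃
  set N : ℝ := ∫ x, ‖g x‖ ^ 2 with hN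
  set c : ℂ := ∫ x, g x * (Real.cosh (x / 2) : ℂ) with hc
  -- the two reflection inequalities
  obtain ⟨hW₂0, hineq₂⟩ := reflection_inequality_at hg hsupp ha2 ha4 hω₂ hκ₂0 hκB₂ hm₂ hCM₂ hCA₂ hIA₂
  obtain ⟨hW₃0, hineq₃⟩ := reflection_inequality_at hg hsupp ha3 (ha4.trans hlog23.le) hω₃ hκ₃0 hκB₃
    hm₃ hCM₃ hCA₃ hIA₃
  set W₂ : ℝ := B₂ * N + 2 * κ₂ * (ω₂ * kL₂).re with hW₂
  set W₃ : ℝ := B₃ * N + 2 * κ₃ * (ω₃ * kL₃).re with hW₃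
  set G₂ : ℝ := CM₂ / B₂ + (CA₂ + ω₂.re * IA₂) / (B₂ + κ₂) + (CA₂ - ω₂.re * IA₂) / (B₂ - κ₂) with hG₂
  set G₃ : ℝ := CM₃ / B₃ + (CA₃ + ω₃.re * IA₃) / (B₃ + κ₃) + (CA₃ - ω₃.re * IA₃) / (B₃ - κ₃) with hG₃
  -- `t_n G_n ≤ 1` from the cleared criteria
  have hκre₂ : κ₂ * ω₂.re = k₂ * u₂.re := by
    rw [hκ₂, ← hωre₂, hk₂]; ring
  have hκre₃ : κ₃ * ω₃.re = k₃ * u₃.re := by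
    rw [hκ₃, ← hωre₃, hk₃]; ring
  have htG₂ : t₂ * G₂ ≤ 1 := by
    refine mul_G_le_one_of_cleared hκ₂0 hκB₂ ?_
    rw [hκre₂]; exact hcrit₂
  have htG₃ : t₃ * G₃ ≤ 1 := by
    refine mul_G_le_one_of_cleared hκ₃0 hκB₃ ?_
    rw [hκre₃]; exact hcrit₃
  -- convex combination: `2|c|² ≤ W₂ + W₃`
  have hc₂ : t₂ * ‖c‖ ^ 2 ≤ W₂ := by
    have h1 : ‖c‖ ^ 2 ≤ W₂ * G₂ := hineq₂
    have h2 : t₂ * ‖c‖ ^ 2 ≤ t₂ * (W₂ * G₂) := mul_le_mul_of_nonneg_left h1 ht₂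
    have h3 : t₂ * (W₂ * G₂) = W₂ * (t₂ * G₂) := by ring
    have h4 : W₂ * (t₂ * G₂) ≤ W₂ * 1 := mul_le_mul_of_nonneg_left htG₂ hW₂0
    linarith
  have hc₃ : t₃ * ‖c‖ ^ 2 ≤ W₃ := by
    have h1 : ‖c‖ ^ 2 ≤ W₃ * G₃ := hineq₃
    have h2 : t₃ * ‖c‖ ^ 2 ≤ t₃ * (W₃ * G₃) := mul_le_mul_of_nonneg_left h1 ht₃
    have h3 : t₃ * (W₃ * G₃) = W₃ * (t₃ * G₃) := by ring
    have h4 : W₃ * (t₃ * G₃) ≤ W₃ * 1 := mul_le_mul_of_nonneg_left htG₃ hW₃0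
    linarith
  have hc2 : 2 * ‖c‖ ^ 2 ≤ W₂ + W₃ := by
    have h0 : 0 ≤ ‖c‖ ^ 2 := by positivity
    have h5 : 2 * ‖c‖ ^ 2 ≤ (t₂ + t₃) * ‖c‖ ^ 2 := mul_le_mul_of_nonneg_right ht h0
    rw [add_mul] at h5
    linarith only [h5, hc₂, hc₃]
  -- the corrections
  have hk : tsupport (weilConv g (weilReflect g)) ⊆ Icc (-(2 * Real.log 2)) (2 * Real.log 2) :=
    (tsupport_weilConv_weilReflect_subset hg.2 hsupp).trans (Icc_subset_Icc (by linarith) (by linarith))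
  have hD := re_weilPrimeTerm_sub_weilPrimeTermChar_two χ hg hk
  have hDW₂ : 2 * κ₂ * (ω₂ * kL₂).re = 2 * k₂ * (u₂ * kL₂).re := by
    rw [huω₂, mul_assoc (‖u₂‖ : ℂ), Complex.re_ofReal_mul, hκ₂, hk₂]
    ring
  have hDW₃ : 2 * κ₃ * (ω₃ * kL₃).re = 2 * k₃ * (u₃ * kL₃).re := by
    rw [huω₃, mul_assoc (‖u₃‖ : ℂ), Complex.re_ofReal_mul, hκ₃, hk₃]
    ring
  have hmain := re_weilQuadraticChar_ge hq1 χ hg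
  have hζg : 0 ≤ (weilQuadratic g).re := hζ g hg hsupp
  have hP := two_mul_re_weilMellin_le hg
  have hN0 : 0 ≤ N := integral_nonneg fun t ↦ by positivity
  have hNB : (B₂ + B₃) * N ≤ N * Real.log q := by
    have h := mul_le_mul_of_nonneg_left (hBB.trans hBq) hN0
    rwa [mul_comm N (B₂ + B₃)] at h
  rw [hD] at hmain
  rw [hW₂, hW₃, hDW₂, hDW₃] at hc2
  linarith

end Summit.Ventures.WeilGRH
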